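import Literature.AlgebraicGeometry.ShimuraVarieties.UnitaryBallUniformisationLocalSection
import Literature.AlgebraicGeometry.ShimuraVarieties.UnitaryBallDiscontinuity
import Literature.NumberTheory.Transcendental.AnalytificationMorphisms
import HarnessLib

/-!
# Sub-ball inclusions and translations between compact ball quotients are morphisms of the models (any ranks)

Topic `AlgebraicGeometry/ShimuraVarieties`, namespace `Literature.AlgebraicGeometry.ShimuraVarieties` (grouping
sub-namespace `UnitaryBallSubBallMorphism`; the rank-free companion of ★ `UnitaryBallHeckeTranslation`, whose statements are
the square case `p₁ = p₂ = 2`). THEOREMS ONLY (no definition, no named fact, no instance, no `sorry`).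

Let `D₁ : UnitaryBallUniformisationDatum p₁ Y`, `D₂ : UnitaryBallUniformisationDatum p₂ X` be uniformisations
`Γ₁∖𝔹^{p₁} ≅ Y(ℂ)`, `Γ₂∖𝔹^{p₂} ≅ X(ℂ)` of smooth projective varieties (cone coordinates: `unifᵢ` lives on the negative cone of
`Hᵢ^{τ₁}` in `ℂ^{pᵢ+1}`), and let `M ∈ M_{(p₂+1)×(p₁+1)}(ℂ)` be a complex matrix which (`hcone`) carries the negative cone of
`H₁^{τ₁}` into that of `H₂^{τ₁}` (e.g. an isometric embedding `Mᴴ H₂^{τ₁} M = H₁^{τ₁}`, `mulVec_mem_cone_of_gram`) and (`hgroup`)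
along which every `γ₁ ∈ Γ₁` is the restriction of some `γ₂ ∈ Γ₂`: `γ₂^{τ₁} · M = M · γ₁^{τ₁}` — the shape of the tree's
★ `IsCompatibleSpecialSource` (`UnitaryBallH1RestrictionToSpecialCurves`: fields `gram`, `group`, `unif_comp`).  We prove:

* `unif_mulVec_eq_of_unif_eq`, `exists_map_unif_mulVec_eq` — `v ↦ unif₂ (M v)` is constant on the fibres of `unif₁`
  (`Γ₁·ℂˣ`-orbits), so there is a map `f : Y(ℂ) → X(ℂ)` with `f (unif₁ v) = unif₂ (M v)` on the cone («`[v] ↦ [M v]`»);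
* `mdifferentiable_of_map_unif_mulVec_eq` — if `unif₁` is injective modulo `ℂˣ` near every cone vector (hypothesis `hinj`),
  ANY such `f`, read in Hodge models `A₁`, `A₂`, is HOLOMORPHIC: near `x` it is `(ψ₂⁻¹ ∘ unif₂ ∘ M) ∘ σ` for a holomorphic local
  section `σ` of `ψ₁⁻¹ ∘ unif₁` (★ `UnitaryBallUniformisationLocalSection.exists_mdifferentiableAt_section`) and `ψ₂⁻¹ ∘ unif₂`
  is holomorphic on the cone (★ `mdifferentiableAt_symm_comp_unif`) — no ball model, no frame, no local biholomorphy of the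
  TARGET is used;
* `exists_hom_map_unif_mulVec_eq` — under ★ `Arapura2012_Cor_15_4_6` (a tree THEOREM, `arapura2012_cor_15_4_6_holds`; kept as a
  hypothesis to stay on a light import cone, as in ★ `UnitaryBallHeckeTranslation`) there is a morphism `φ : Y ⟶ X` of the
  `ℂ`-schemes with `φ(ℂ)(unif₁ v) = unif₂ (M v)` on the cone;
* `exists_isOpen_forall_eq_smul_of_subBall` — when the TARGET is a ball quotient of rank `2` and `M` is injective, the
  hypothesis `hinj` on the SOURCE is automatic: `Γ₂` acts freely and properly discontinuously on `𝔹²` (★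
  `UnitaryBallDiscontinuity.exists_isOpen_forall_smul_mem_imp`, read on the cone through ★ `coneChart`), and a coincidence
  `γ₁ v = c w` of the source is carried by `M` to a coincidence `γ₂ (M v) = c (M w)` of the target; whence
  `exists_hom_map_unif_mulVec_eq_two` — **every compatible sub-datum `(D₁, M)` of a rank-2 ball quotient `D₂` (cone + group
  clauses, `M` injective) comes with the morphism `Y ⟶ X`, `[v] ↦ [M v]`** (the existence half of ★ `IsCompatibleSpecialSource`,
  and, for `p₁ = 1`, the complex half of the GS programme's embedding `Sh(U(J⋆), 𝔻) → Sh(U(H), 𝔹²)`).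

## References
* [Shimura1973] G. Shimura, *Introduction to the arithmetic theory of automorphic functions* (1971), §7.2–7.3.
* [BergeronMillsonMoeglin2016Balls] N. Bergeron, J. Millson, C. Moeglin, Acta Math. 216 (2016), Introduction §1.1, Part 2
  §§1.3, 3.1–3.3 (special cycles `Γ_W∖𝔹(W^⊥) → Γ∖𝔹`).
* [Arapura2012] D. Arapura, *Algebraic Geometry over the Complex Numbers* (2012), §15.4 Cor. 15.4.6.
* [FritzscheGrauert2002] K. Fritzsche, H. Grauert, *From Holomorphic Functions to Complex Manifolds* (2002), Ch. I §8.
* [Borel1969] A. Borel, *Introduction aux groupes arithmétiques* (1969), Prop. 7.13.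
-/

set_option autoImplicit false

noncomputable section

open Set Function Filter Matrix TopologicalSpace
open scoped Manifold ContDiff Topology

namespace Literature.AlgebraicGeometry.ShimuraVarieties

open Literature.AlgebraicGeometry.Motives (ComplexPoints AlgPoints SchemeOver)
open Literature.AlgebraicGeometry.HodgeTheory (HodgeModel)
open Literature.NumberTheory.Transcendental
open Literature.Geometry.ComplexHyperbolic
open Literature.Geometry.ComplexHyperbolic.BallModel (Ball)
open CategoryTheory

namespace UnitaryBallSubBallMorphism

open UnitaryBallUniformisationDatum

variable {p₁ p₂ : ℕ} {Y X : SchemeOver ℂ} {D₁ : UnitaryBallUniformisationDatum p₁ Y}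
  {D₂ : UnitaryBallUniformisationDatum p₂ X} {M : Matrix (Fin (p₂ + 1)) (Fin (p₁ + 1)) ℂ}

/-! ### §1. Isometric matrices: cone and injectivity -/

/-- `(M v)ᴴ H₂ (M v) = vᴴ (Mᴴ H₂ M) v` for a rectangular `M`. [folklore] -/
private theorem star_mulVec_dotProduct_mulVec (H₂ : Matrix (Fin (p₂ + 1)) (Fin (p₂ + 1)) ℂ) (v : Fin (p₁ + 1) → ℂ) :
    star (M *ᵥ v) ⬝ᵥ (H₂ *ᵥ (M *ᵥ v)) = star v ⬝ᵥ ((Mᴴ * H₂ * M) *ᵥ v) := by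
  rw [star_mulVec, mulVec_mulVec, dotProduct_mulVec, vecMul_vecMul, ← Matrix.mul_assoc, ← dotProduct_mulVec]

/-- **An isometric matrix carries the negative cone into the negative cone**: `Mᴴ H₂^{τ₁} M = H₁^{τ₁}` gives
`⟪M v, M v⟫₂ = ⟪v, v⟫₁`. [cite: BergeronMillsonMoeglin2016Balls, Part 2 §1.3 and §3.1] -/
theorem mulVec_mem_cone_of_gram (hM : Mᴴ * D₂.Hℂ * M = D₁.Hℂ) {v : Fin (p₁ + 1) → ℂ} (hv : v ∈ D₁.cone) :
    M *ᵥ v ∈ D₂.cone := by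
  rw [mem_negCone_iff]
  change (star (M *ᵥ v) ⬝ᵥ (D₂.Hℂ *ᵥ (M *ᵥ v))).re < 0
  rw [star_mulVec_dotProduct_mulVec, hM]
  exact hv

/-- The Gram matrix `H^{τ₁}` of a ball-quotient datum is invertible (it is congruent to `diag(1,…,1,-1)`, the datum's
`signature_τ₁`). [cite: BergeronMillsonMoeglin2016Balls, Part 2 §1.1] -/
theorem isUnit_det_Hℂ (D : UnitaryBallUniformisationDatum p₁ Y) : IsUnit D.Hℂ.det := by
  obtain ⟨T, hT⟩ := D.signature_τ₁
  have hdet : (signatureMatrix p₁).det ≠ 0 := by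
    rw [signatureMatrix, det_diagonal]
    refine Finset.prod_ne_zero_iff.2 fun i _ => ?_
    split_ifs <;> norm_num
  have h := congrArg Matrix.det hT
  rw [det_mul, det_mul] at h
  refine isUnit_iff_ne_zero.2 fun h0 => hdet ?_
  rw [← h]
  change (T : Matrix (Fin (p₁ + 1)) (Fin (p₁ + 1)) ℂ)ᴴ.det * D.Hℂ.det * (T : Matrix (Fin (p₁ + 1)) (Fin (p₁ + 1)) ℂ).det = 0
  rw [h0, mul_zero, zero_mul]

/-- **An isometric matrix is injective** (`H₁^{τ₁}` being non-degenerate): `Mᴴ H₂ M = H₁`, `M v = M w ⇒ v = w`.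
[cite: BergeronMillsonMoeglin2016Balls, Part 2 §3.1] -/
theorem mulVec_injective_of_gram (hM : Mᴴ * D₂.Hℂ * M = D₁.Hℂ) : Function.Injective fun v : Fin (p₁ + 1) → ℂ => M *ᵥ v := by
  intro v w h
  have h' : D₁.Hℂ *ᵥ v = D₁.Hℂ *ᵥ w := by
    rw [← hM, ← mulVec_mulVec, ← mulVec_mulVec, ← mulVec_mulVec, ← mulVec_mulVec]
    exact congrArg (fun u => Mᴴ *ᵥ (D₂.Hℂ *ᵥ u)) h
  exact (Matrix.mulVec_injective_iff_isUnit.2 ((Matrix.isUnit_iff_isUnit_det _).2 (isUnit_det_Hℂ D₁))) h'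

/-! ### §2. The point map `[v] ↦ [M v]` -/

/-- **`unif₂ (M v)` is constant on the fibres of `unif₁`**: the fibres on the cone are the `Γ₁·ℂˣ`-orbits, and a relation
`γ₁ v = c w` is carried by `M` to `γ₂ (M v) = c (M w)` with `γ₂^{τ₁} M = M γ₁^{τ₁}`.
[cite: Shimura1973, §7.2–7.3] [cite: BergeronMillsonMoeglin2016Balls, Part 2 §3.1] -/
theorem unif_mulVec_eq_of_unif_eq (hcone : ∀ v ∈ D₁.cone, M *ᵥ v ∈ D₂.cone)
    (hgroup : ∀ γ₁ ∈ D₁.Γ, ∃ γ₂ ∈ D₂.Γ,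
      ((γ₂ : GL (Fin (p₂ + 1)) D₂.E) : Matrix (Fin (p₂ + 1)) (Fin (p₂ + 1)) D₂.E).map D₂.τ₁ * M =
        M * ((γ₁ : GL (Fin (p₁ + 1)) D₁.E) : Matrix (Fin (p₁ + 1)) (Fin (p₁ + 1)) D₁.E).map D₁.τ₁)
    {v w : Fin (p₁ + 1) → ℂ} (hv : v ∈ D₁.cone) (hw : w ∈ D₁.cone) (h : D₁.unif v = D₁.unif w) :
    D₂.unif (M *ᵥ v) = D₂.unif (M *ᵥ w) := by
  obtain ⟨γ₁, hγ₁, c, hc, hγv⟩ := (D₁.unif_eq_unif_iff v hv w hw).1 h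
  obtain ⟨γ₂, hγ₂, hγM⟩ := hgroup γ₁ hγ₁
  refine (D₂.unif_eq_unif_iff _ (hcone v hv) _ (hcone w hw)).2 ⟨γ₂, hγ₂, c, hc, ?_⟩
  rw [mulVec_mulVec, hγM, ← mulVec_mulVec, hγv, mulVec_smul]

/-- **The point map exists**: `f : Y(ℂ) → X(ℂ)` with `f (unif₁ v) = unif₂ (M v)` on the cone (`unif₁` is onto and `unif₂ ∘ M`
is constant on its fibres). [cite: Shimura1973, §7.2–7.3] [cite: BergeronMillsonMoeglin2016Balls, Part 2 §3.1] -/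
theorem exists_map_unif_mulVec_eq (hcone : ∀ v ∈ D₁.cone, M *ᵥ v ∈ D₂.cone)
    (hgroup : ∀ γ₁ ∈ D₁.Γ, ∃ γ₂ ∈ D₂.Γ,
      ((γ₂ : GL (Fin (p₂ + 1)) D₂.E) : Matrix (Fin (p₂ + 1)) (Fin (p₂ + 1)) D₂.E).map D₂.τ₁ * M =
        M * ((γ₁ : GL (Fin (p₁ + 1)) D₁.E) : Matrix (Fin (p₁ + 1)) (Fin (p₁ + 1)) D₁.E).map D₁.τ₁) :
    ∃ f : ComplexPoints Y → ComplexPoints X, ∀ v ∈ D₁.cone, f (D₁.unif v) = D₂.unif (M *ᵥ v) := by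
  have hsec : ∀ P : ComplexPoints Y, ∃ v ∈ D₁.cone, D₁.unif v = P := fun P => D₁.surjOn_unif (mem_univ P)
  choose s hs hsP using hsec
  exact ⟨fun P => D₂.unif (M *ᵥ s P), fun v hv => unif_mulVec_eq_of_unif_eq hcone hgroup (hs _) hv (hsP _)⟩

/-! ### §3. Holomorphy through local sections of the source uniformisation -/

/-- `v ↦ ψ₂⁻¹ (unif₂ (M v))` is holomorphic at every `v` with `M v` in the cone of `D₂` (★ `mdifferentiableAt_symm_comp_unif`
composed with the linear map `M`). [cite: SerreGAGA1956, §2 n°6 Prop. 3 Cor. 2] -/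
theorem mdifferentiableAt_symm_comp_unif_mulVec (A₂ : HodgeModel p₂ X) {v : Fin (p₁ + 1) → ℂ} (hv : M *ᵥ v ∈ D₂.cone) :
    MDifferentiableAt 𝓘(ℂ, Fin (p₁ + 1) → ℂ) 𝓘(ℂ, A₂.model)
      (fun v' => A₂.isAnalytification.homeomorph.symm (D₂.unif (M *ᵥ v'))) v := by
  have hM : MDifferentiableAt 𝓘(ℂ, Fin (p₁ + 1) → ℂ) 𝓘(ℂ, Fin (p₂ + 1) → ℂ) (fun v' : Fin (p₁ + 1) → ℂ => M *ᵥ v') v :=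
    mdifferentiableAt_iff_differentiableAt.2 (LinearMap.toContinuousLinearMap (Matrix.mulVecLin M)).differentiableAt
  have h : MDifferentiableAt 𝓘(ℂ, Fin (p₁ + 1) → ℂ) 𝓘(ℂ, A₂.model)
      ((A₂.isAnalytification.homeomorph.symm ∘ D₂.unif) ∘ fun v' : Fin (p₁ + 1) → ℂ => M *ᵥ v') v :=
    (D₂.mdifferentiableAt_symm_comp_unif A₂ hv).comp v hM
  exact h

/-- **Any map intertwining `unif₁` with `unif₂ ∘ M` is holomorphic** (read in Hodge models `A₁`, `A₂`), provided `unif₁` is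
injective modulo `ℂˣ` near every cone vector: near `x ∈ Y^an`, with `σ` a holomorphic local section of `ψ₁⁻¹ ∘ unif₁` through a
cone vector over `x` (★ `exists_mdifferentiableAt_section`), `ψ₂⁻¹ ∘ f ∘ ψ₁ = (ψ₂⁻¹ ∘ unif₂ ∘ M) ∘ σ`, a composite of
holomorphic maps. [cite: FritzscheGrauert2002, Ch. I §8 Cor. 8.6] [cite: Shimura1973, §7.2–7.3] -/
theorem mdifferentiable_of_map_unif_mulVec_eq (hcone : ∀ v ∈ D₁.cone, M *ᵥ v ∈ D₂.cone)
    (hinj : ∀ v₀ ∈ D₁.cone, ∃ U : Set (Fin (p₁ + 1) → ℂ), IsOpen U ∧ v₀ ∈ U ∧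
      ∀ v ∈ U, ∀ w ∈ U, v ∈ D₁.cone → w ∈ D₁.cone → D₁.unif v = D₁.unif w → ∃ c : ℂ, v = c • w)
    {f : ComplexPoints Y → ComplexPoints X} (hf : ∀ v ∈ D₁.cone, f (D₁.unif v) = D₂.unif (M *ᵥ v))
    (A₁ : HodgeModel p₁ Y) (A₂ : HodgeModel p₂ X) :
    MDifferentiable 𝓘(ℂ, A₁.model) 𝓘(ℂ, A₂.model)
      (fun x => A₂.isAnalytification.homeomorph.symm (f (A₁.toComplexPoints x))) := by
  intro x
  obtain ⟨v₀, hv₀, hP⟩ := D₁.surjOn_unif (mem_univ (A₁.toComplexPoints x))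
  obtain ⟨W, σ, hWo, hx₀W, -, hσ, hσd⟩ := D₁.exists_mdifferentiableAt_section A₁ hv₀ (hinj v₀ hv₀)
  have hx₀ : A₁.isAnalytification.homeomorph.symm (D₁.unif v₀) = x := by
    rw [hP]; exact A₁.isAnalytification.homeomorph.symm_apply_apply x
  rw [hx₀] at hx₀W
  -- `ψ₂⁻¹ ∘ f ∘ ψ₁ = (ψ₂⁻¹ ∘ unif₂ ∘ M) ∘ σ` near `x`
  have key : (fun x' => A₂.isAnalytification.homeomorph.symm (f (A₁.toComplexPoints x'))) =ᶠ[𝓝 x]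
      fun x' => A₂.isAnalytification.homeomorph.symm (D₂.unif (M *ᵥ σ x')) := by
    filter_upwards [hWo.mem_nhds hx₀W] with x' hx'
    rw [← (hσ x' hx').2, hf _ (hσ x' hx').1]
  refine MDifferentiableAt.congr_of_eventuallyEq ?_ key
  have hG := mdifferentiableAt_symm_comp_unif_mulVec (D₂ := D₂) (M := M) A₂ (hcone _ (hσ x hx₀W).1)
  have hcomp : MDifferentiableAt 𝓘(ℂ, A₁.model) 𝓘(ℂ, A₂.model)
      ((fun v' => A₂.isAnalytification.homeomorph.symm (D₂.unif (M *ᵥ v'))) ∘ σ) x :=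
    hG.comp x (hσd x hx₀W)
  exact hcomp

/-! ### §4. Algebraicity -/

/-- **The sub-ball translation is a morphism of the models** (under ★ `Arapura2012_Cor_15_4_6`: a holomorphic map between
nonsingular projective varieties is a morphism): for `M` carrying the cone of `D₁` into that of `D₂`, compatible with the
groups, and `unif₁` injective modulo `ℂˣ` near every cone vector, there is `φ : Y ⟶ X` over `ℂ` with
`φ(ℂ) (unif₁ v) = unif₂ (M v)` on the cone.  The Hodge models are inputs; the conclusion does not mention them.
[cite: Arapura2012, §15.4 Cor. 15.4.6] [cite: BergeronMillsonMoeglin2016Balls, Part 2 §§3.1–3.3] [cite: Shimura1973, §7.2–7.3] -/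
theorem exists_hom_map_unif_mulVec_eq (hA : Arapura2012_Cor_15_4_6) (hcone : ∀ v ∈ D₁.cone, M *ᵥ v ∈ D₂.cone)
    (hgroup : ∀ γ₁ ∈ D₁.Γ, ∃ γ₂ ∈ D₂.Γ,
      ((γ₂ : GL (Fin (p₂ + 1)) D₂.E) : Matrix (Fin (p₂ + 1)) (Fin (p₂ + 1)) D₂.E).map D₂.τ₁ * M =
        M * ((γ₁ : GL (Fin (p₁ + 1)) D₁.E) : Matrix (Fin (p₁ + 1)) (Fin (p₁ + 1)) D₁.E).map D₁.τ₁)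
    (hinj : ∀ v₀ ∈ D₁.cone, ∃ U : Set (Fin (p₁ + 1) → ℂ), IsOpen U ∧ v₀ ∈ U ∧
      ∀ v ∈ U, ∀ w ∈ U, v ∈ D₁.cone → w ∈ D₁.cone → D₁.unif v = D₁.unif w → ∃ c : ℂ, v = c • w)
    (A₁ : HodgeModel p₁ Y) (A₂ : HodgeModel p₂ X) :
    ∃ φ : Y ⟶ X, ∀ v ∈ D₁.cone, AlgPoints.map φ (D₁.unif v) = D₂.unif (M *ᵥ v) := by
  obtain ⟨f, hf⟩ := exists_map_unif_mulVec_eq hcone hgroup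
  obtain ⟨φ, hφ⟩ := hA Y X D₁.isSmoothProjective D₂.isSmoothProjective A₁.model A₁.carrier
    A₁.toComplexPoints A₁.isAnalytification A₂.model A₂.carrier A₂.toComplexPoints
    A₂.isAnalytification _ (mdifferentiable_of_map_unif_mulVec_eq hcone hinj hf A₁ A₂)
  refine ⟨φ, fun v hv => ?_⟩
  have h := hφ (A₁.isAnalytification.homeomorph.symm (D₁.unif v))
  have h₁ : A₁.toComplexPoints (A₁.isAnalytification.homeomorph.symm (D₁.unif v)) = D₁.unif v :=
    A₁.isAnalytification.homeomorph.apply_symm_apply _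
  have h₂ : A₂.toComplexPoints (A₂.isAnalytification.homeomorph.symm (f (D₁.unif v))) = f (D₁.unif v) :=
    A₂.isAnalytification.homeomorph.apply_symm_apply _
  rw [h₁, h₂, hf v hv] at h
  exact h.symm

/-- The same with the analytifications supplied by any existence statement for Hodge models (e.g. ★
`HodgeTheory.exists_isReal_hodgeModel_holds`). [cite: Arapura2012, §15.4 Cor. 15.4.6] [cite: BergeronMillsonMoeglin2016Balls, Part 2 §3.1] -/
theorem exists_hom_map_unif_mulVec_eq_of_nonempty (hA : Arapura2012_Cor_15_4_6) (hA₁ : Nonempty (HodgeModel p₁ Y))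
    (hA₂ : Nonempty (HodgeModel p₂ X)) (hcone : ∀ v ∈ D₁.cone, M *ᵥ v ∈ D₂.cone)
    (hgroup : ∀ γ₁ ∈ D₁.Γ, ∃ γ₂ ∈ D₂.Γ,
      ((γ₂ : GL (Fin (p₂ + 1)) D₂.E) : Matrix (Fin (p₂ + 1)) (Fin (p₂ + 1)) D₂.E).map D₂.τ₁ * M =
        M * ((γ₁ : GL (Fin (p₁ + 1)) D₁.E) : Matrix (Fin (p₁ + 1)) (Fin (p₁ + 1)) D₁.E).map D₁.τ₁)
    (hinj : ∀ v₀ ∈ D₁.cone, ∃ U : Set (Fin (p₁ + 1) → ℂ), IsOpen U ∧ v₀ ∈ U ∧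
      ∀ v ∈ U, ∀ w ∈ U, v ∈ D₁.cone → w ∈ D₁.cone → D₁.unif v = D₁.unif w → ∃ c : ℂ, v = c • w) :
    ∃ φ : Y ⟶ X, ∀ v ∈ D₁.cone, AlgPoints.map φ (D₁.unif v) = D₂.unif (M *ᵥ v) :=
  let ⟨A₁⟩ := hA₁; let ⟨A₂⟩ := hA₂; exists_hom_map_unif_mulVec_eq hA hcone hgroup hinj A₁ A₂

end UnitaryBallSubBallMorphism

/-! ### §5. Sub-data of a rank-2 ball quotient: local injectivity of the source is automatic -/

namespace UnitaryBallSubBallMorphism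

open UnitaryBallUniformisationDatum

variable {p₁ : ℕ} {Y X : SchemeOver ℂ} {D₁ : UnitaryBallUniformisationDatum p₁ Y}
  {D₂ : UnitaryBallUniformisationDatum 2 X} {M : Matrix (Fin 3) (Fin (p₁ + 1)) ℂ}

/-- **Local injectivity modulo `ℂˣ` of the source uniformisation, from the target**: if `M` is injective, carries the cone of
`D₁` into that of the rank-2 datum `D₂` and restricts `Γ₂` onto `Γ₁`, then near every cone vector `v₀` of `D₁`, cone vectors
with the same image under `unif₁` are proportional — a coincidence `γ₁ v = c w` near `v₀` becomes `γ₂ (M v) = c (M w)` near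
the ball point of `M v₀`, where `Γ₂` acts freely and properly discontinuously (★ `exists_isOpen_forall_smul_mem_imp`), so
`γ₂ = 1` and `M v = c M w`. [cite: Borel1969, Prop. 7.13] [cite: BergeronMillsonMoeglin2016Balls, Introduction §1.1 and Part 2 §3.1] -/
theorem exists_isOpen_forall_eq_smul_of_subBall (hcone : ∀ v ∈ D₁.cone, M *ᵥ v ∈ D₂.cone)
    (hMinj : Function.Injective fun v : Fin (p₁ + 1) → ℂ => M *ᵥ v)
    (hgroup : ∀ γ₁ ∈ D₁.Γ, ∃ γ₂ ∈ D₂.Γ,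
      ((γ₂ : GL (Fin 3) D₂.E) : Matrix (Fin 3) (Fin 3) D₂.E).map D₂.τ₁ * M =
        M * ((γ₁ : GL (Fin (p₁ + 1)) D₁.E) : Matrix (Fin (p₁ + 1)) (Fin (p₁ + 1)) D₁.E).map D₁.τ₁)
    {v₀ : Fin (p₁ + 1) → ℂ} (hv₀ : v₀ ∈ D₁.cone) :
    ∃ U : Set (Fin (p₁ + 1) → ℂ), IsOpen U ∧ v₀ ∈ U ∧
      ∀ v ∈ U, ∀ w ∈ U, v ∈ D₁.cone → w ∈ D₁.cone → D₁.unif v = D₁.unif w → ∃ c : ℂ, v = c • w := by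
  obtain ⟨𝔣⟩ := D₂.nonempty_sylvesterFrame
  -- the ball chart of the image cone vector, on the source cone
  set g : D₁.cone → Ball := fun v => D₂.coneChart 𝔣 ⟨M *ᵥ (v : Fin (p₁ + 1) → ℂ), hcone _ v.2⟩ with hg
  have hgc : Continuous g := by
    refine (D₂.continuous_coneChart 𝔣).comp (Continuous.subtype_mk ?_ _)
    exact continuous_const.matrix_mulVec continuous_subtype_val
  obtain ⟨Ub, hUbo, hz₀, hUb⟩ := D₂.exists_isOpen_forall_smul_mem_imp 𝔣 (g ⟨v₀, hv₀⟩)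
  obtain ⟨U, hUo, hU⟩ := isOpen_induced_iff.1 (hUbo.preimage hgc)
  have hmemU : ∀ v : D₁.cone, (v : Fin (p₁ + 1) → ℂ) ∈ U ↔ g v ∈ Ub := fun v => by
    change v ∈ Subtype.val ⁻¹' U ↔ v ∈ g ⁻¹' Ub
    rw [hU]
  refine ⟨U, hUo, (hmemU ⟨v₀, hv₀⟩).2 hz₀, fun v hvU w hwU hv hw h => ?_⟩
  obtain ⟨γ₁, hγ₁, c, hc, hγv⟩ := (D₁.unif_eq_unif_iff v hv w hw).1 h
  obtain ⟨γ₂, hγ₂, hγM⟩ := hgroup γ₁ hγ₁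
  -- `γ₂ (M v) = c (M w)` on the target cone
  have hvec : ((γ₂ : GL (Fin 3) D₂.E) : Matrix (Fin 3) (Fin 3) D₂.E).map D₂.τ₁ *ᵥ (M *ᵥ v) = c • (M *ᵥ w) := by
    rw [mulVec_mulVec, hγM, ← mulVec_mulVec, hγv, mulVec_smul]
  have hact : D₂.toRealPoints ⟨γ₂, hγ₂⟩ • (⟨M *ᵥ v, hcone v hv⟩ : D₂.cone) =
      ⟨c • (M *ᵥ w), smul_mem_negCone hc (hcone w hw)⟩ := Subtype.ext hvec
  have hchart : D₂.ballRep 𝔣 ⟨γ₂, hγ₂⟩ • g ⟨v, hv⟩ = g ⟨w, hw⟩ := by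
    rw [hg]
    dsimp only
    rw [← D₂.coneChart_act 𝔣 ⟨γ₂, hγ₂⟩, hact]
    exact D₂.coneChart_lineSMul 𝔣 hc ⟨M *ᵥ w, hcone w hw⟩
  have hone : (⟨γ₂, hγ₂⟩ : D₂.Γ) = 1 :=
    hUb ⟨γ₂, hγ₂⟩ (g ⟨v, hv⟩) ((hmemU ⟨v, hv⟩).1 hvU) (by rw [hchart]; exact (hmemU ⟨w, hw⟩).1 hwU)
  have hγ₂one : γ₂ = 1 := congrArg Subtype.val hone
  -- hence `M v = M (c w)` and `v = c w`
  refine ⟨c, hMinj ?_⟩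
  change M *ᵥ v = M *ᵥ (c • w)
  rw [mulVec_smul, ← hvec, hγ₂one, Units.val_one, Matrix.map_one _ (map_zero _) (map_one _), one_mulVec]

/-- **Compatible sub-data of a rank-2 ball quotient come with the morphism** (Arapura): for a uniformised `Y(ℂ) ≅ Γ₁∖𝔹^{p₁}`,
a rank-2 ball quotient `X(ℂ) ≅ Γ₂∖𝔹²`, and an injective `M` carrying cone to cone along which `Γ₁` is restricted from `Γ₂`,
there is `φ : Y ⟶ X` with `φ(ℂ)(unif₁ v) = unif₂ (M v)` on the cone — for `p₁ = 1` the special curve / sub-Shimura curve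
`Γ₁∖𝔻 → Γ₂∖𝔹²` ([BergeronMillsonMoeglin2016Balls] Part 2 §§3.1–3.3; [Liu2021] proof of Thm. 4.15, «the morphism
`Sh(G⋆, h⋆) → Sh(G, h)`»), for `p₁ = 2` the Hecke translations of ★ `UnitaryBallHeckeTranslation`.
[cite: Arapura2012, §15.4 Cor. 15.4.6] [cite: BergeronMillsonMoeglin2016Balls, Part 2 §§3.1–3.3] [cite: Borel1969, Prop. 7.13] -/
theorem exists_hom_map_unif_mulVec_eq_two (hA : Arapura2012_Cor_15_4_6) (hA₁ : Nonempty (HodgeModel p₁ Y))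
    (hA₂ : Nonempty (HodgeModel 2 X)) (hcone : ∀ v ∈ D₁.cone, M *ᵥ v ∈ D₂.cone)
    (hMinj : Function.Injective fun v : Fin (p₁ + 1) → ℂ => M *ᵥ v)
    (hgroup : ∀ γ₁ ∈ D₁.Γ, ∃ γ₂ ∈ D₂.Γ,
      ((γ₂ : GL (Fin 3) D₂.E) : Matrix (Fin 3) (Fin 3) D₂.E).map D₂.τ₁ * M =
        M * ((γ₁ : GL (Fin (p₁ + 1)) D₁.E) : Matrix (Fin (p₁ + 1)) (Fin (p₁ + 1)) D₁.E).map D₁.τ₁) :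
    ∃ φ : Y ⟶ X, ∀ v ∈ D₁.cone, AlgPoints.map φ (D₁.unif v) = D₂.unif (M *ᵥ v) :=
  exists_hom_map_unif_mulVec_eq_of_nonempty hA hA₁ hA₂ hcone hgroup
    fun _ hv₀ => exists_isOpen_forall_eq_smul_of_subBall hcone hMinj hgroup hv₀

/-- **The isometric case** (`Mᴴ H₂^{τ₁} M = H₁^{τ₁}`, the `gram` clause of ★ `IsCompatibleSpecialSource`): cone and injectivity
clauses are automatic (`mulVec_mem_cone_of_gram`, `mulVec_injective_of_gram`), so `gram` + `group` give the morphism `φ : Y ⟶ X`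
with `φ(ℂ)(unif₁ v) = unif (M v)` — the `unif_comp` clause.
[cite: Arapura2012, §15.4 Cor. 15.4.6] [cite: BergeronMillsonMoeglin2016Balls, Part 2 §§3.1–3.3] -/
theorem exists_hom_map_unif_mulVec_eq_of_gram (hA : Arapura2012_Cor_15_4_6) (hA₁ : Nonempty (HodgeModel p₁ Y))
    (hA₂ : Nonempty (HodgeModel 2 X)) (hM : Mᴴ * D₂.Hℂ * M = D₁.Hℂ)
    (hgroup : ∀ γ₁ ∈ D₁.Γ, ∃ γ₂ ∈ D₂.Γ,
      ((γ₂ : GL (Fin 3) D₂.E) : Matrix (Fin 3) (Fin 3) D₂.E).map D₂.τ₁ * M =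
        M * ((γ₁ : GL (Fin (p₁ + 1)) D₁.E) : Matrix (Fin (p₁ + 1)) (Fin (p₁ + 1)) D₁.E).map D₁.τ₁) :
    ∃ φ : Y ⟶ X, ∀ v ∈ D₁.cone, AlgPoints.map φ (D₁.unif v) = D₂.unif (M *ᵥ v) :=
  exists_hom_map_unif_mulVec_eq_two hA hA₁ hA₂ (fun _ hv => mulVec_mem_cone_of_gram hM hv)
    (mulVec_injective_of_gram hM) hgroup

end UnitaryBallSubBallMorphism

end Literature.AlgebraicGeometry.ShimuraVarieties

end
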